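import Summits.CriticalPhenomena.PercolationContinuityZ3.Theorems.SahiMasterFamilyE3FSplit
import Summits.CriticalPhenomena.PercolationContinuityZ3.Theorems.SahiMasterFamilyPointwiseTensor
import HarnessLib

/-!
# Kahn's `C₃` on the class `(A, Y, K ∩ G″)` — third member = (event independent of the second) ∩ (event containing the second)

Unit `prim-master-conj` (crux anchor stmt-CriticalPhenomena-4575, helper work), gen 30; memo
`run/shared/lean/prim/prim-l12/prim-master-conj/POINTWISE.md` §31.3.

WHY THIS CLASS.  The one-coordinate method at order 3 (gens 15–20, 30) reduces `MD₃` on the `0`-minor side to `Λ ≥ 0`; with trivial forced hull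
this is THEOREM F plus bookkeeping (`…ZeroFlagMinorFGeneral`, gen 30).  With a nontrivial hull `K` and only the first member depending on the glued
coordinate, `t ↦ E₃(U_t)` is affine and `MD₃` at `(U,e)` is EXACTLY Kahn's `C₃` for the `1`-minor, which has the shape
`(A, Y, K ∩ G″)` with `Y ⟂ K` and `Y ⊆ G″`.  That class is not a meet-containment, independent-pair or junta class, but it is easy:

* `sahiE_three_ind_ge_of_indep_inter_absorb` — for increasing `A, Y, K, G″` with `Y ⊆ G″` and `μ_p(Y∩K) = μ_pY·μ_pK`:
  **`E₃(μ_p; A, Y, K∩G″) ≥ (μK − μ(K∩G″))·Cov(A,Y)`**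
  (algebra: `E₃ − (κ−g)Cov(A,Y) = [μ(AYK) − μY·μ(A∩K∩G″)] + [μ(AYK) − μK·μ(AY)]`; then `μ(A∩K∩G″) ≤ μ(A∩K)` and Harris twice);
* **`sahiE_three_ind_nonneg_of_indep_inter_absorb`** — hence `E₃ ≥ 0` there (Harris once more for `Cov(A,Y) ≥ 0` and `μK ≥ μ(K∩G″)`);
  `…_of_determinedBy` — the structural version (`Y` determined by `F`, `K` by `Fᶜ`, so `Y ⟂ K` at every `p`).
  NOTE: `G″` need NOT be increasing — the third member may be ANY event `C` with `K ∩ Y ⊆ C ⊆ K` (write `C = K ∩ G″`, `G″ := C ∪ Y`).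
HONEST FRAMING: three Harris inequalities; recorded because it closes the sub-case "only one member depends on `e`" of the general-hull
`0`-minor problem (POINTWISE §31.3).  `C₃` in general remains OPEN. [this work]
-/

noncomputable section

open scoped Classical

namespace Summit.CriticalPhenomena.PercolationContinuityZ3.Theorems

namespace SahiE3FSplit

open Finset Function
open Literature.Combinatorics.Sahi2008
open Literature.Probability.Percolation (DeterminedBy)
open Literature.Probability.Percolation.DecisionTree (ind ind_nonneg ind_of_mem ind_of_not_mem)

variable {ι : Type} [Fintype ι]

local notation3 (prettyPrint := false) "μ⟦" q ", " X "⟧" => ex (bernoulliWeight q) (ind X)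

/-- **`E₃(A, Y, K∩G″) ≥ (μK − μ(K∩G″))·Cov(A,Y)`** for increasing `A, Y, K, G″` with `Y ⊆ G″` and `Y ⟂ K` at `μ_p`. [this work] -/
theorem sahiE_three_ind_ge_of_indep_inter_absorb (p : ι → unitInterval) {A Y K G'' : Set (Set ι)}
    (hA : IsUpperSet A) (hY : IsUpperSet Y) (hK : IsUpperSet K) (hYG : Y ⊆ G'')
    (hYK : μ⟦p, Y ∩ K⟧ = μ⟦p, Y⟧ * μ⟦p, K⟧) :
    (μ⟦p, K⟧ - μ⟦p, K ∩ G''⟧) * (μ⟦p, A ∩ Y⟧ - μ⟦p, A⟧ * μ⟦p, Y⟧)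
      ≤ sahiE (bernoulliWeight p) 3 ![ind A, ind Y, ind (K ∩ G'')] := by
  rw [sahiE_three, ind_mul_ind_eq_inter, ind_mul_ind_eq_inter, ind_mul_ind_eq_inter, ind_mul_ind_eq_inter]
  -- set identities from `Y ⊆ G″`
  have eAYG : A ∩ Y ∩ (K ∩ G'') = A ∩ Y ∩ K := by
    ext ω; simp only [Set.mem_inter_iff]
    constructor
    · rintro ⟨⟨hA', hY'⟩, hK', _⟩; exact ⟨⟨hA', hY'⟩, hK'⟩
    · rintro ⟨⟨hA', hY'⟩, hK'⟩; exact ⟨⟨hA', hY'⟩, hK', hYG hY'⟩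
  have eYG : Y ∩ (K ∩ G'') = Y ∩ K := by
    ext ω; simp only [Set.mem_inter_iff]
    constructor
    · rintro ⟨hY', hK', _⟩; exact ⟨hY', hK'⟩
    · rintro ⟨hY', hK'⟩; exact ⟨hY', hK', hYG hY'⟩
  rw [eAYG, eYG, hYK]
  -- Harris twice, one monotonicity
  have h1 : μ⟦p, A ∩ K⟧ * μ⟦p, Y⟧ ≤ μ⟦p, A ∩ K ∩ Y⟧ := harris_ex_ind p (hA.inter hK) hY
  have h2 : μ⟦p, A ∩ Y⟧ * μ⟦p, K⟧ ≤ μ⟦p, A ∩ Y ∩ K⟧ := harris_ex_ind p (hA.inter hY) hK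
  have h3 : μ⟦p, A ∩ (K ∩ G'')⟧ ≤ μ⟦p, A ∩ K⟧ := by
    have : μ⟦p, A ∩ K ∩ (K ∩ G'')⟧ ≤ μ⟦p, A ∩ K⟧ := ex_ind_inter_le_left p (A ∩ K) (K ∩ G'')
    have e : A ∩ K ∩ (K ∩ G'') = A ∩ (K ∩ G'') := by
      ext ω; simp only [Set.mem_inter_iff]; tauto
    rwa [e] at this
  have e3 : A ∩ K ∩ Y = A ∩ Y ∩ K := by ac_rfl
  rw [e3] at h1
  have hy : 0 ≤ μ⟦p, Y⟧ := ex_nonneg (isFKGMeasure_bernoulliWeight p).nonneg fun ω => ind_nonneg Y ω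
  nlinarith [h1, h2, mul_le_mul_of_nonneg_right h3 hy]

/-- **Kahn's `C₃` on the class `(A, Y, K∩G″)`**: for increasing `A, Y, K, G″` with `Y ⊆ G″` and `μ_p(Y∩K) = μ_pY·μ_pK`,
`E₃(μ_p; A, Y, K∩G″) ≥ 0`. [this work] -/
theorem sahiE_three_ind_nonneg_of_indep_inter_absorb (p : ι → unitInterval) {A Y K G'' : Set (Set ι)}
    (hA : IsUpperSet A) (hY : IsUpperSet Y) (hK : IsUpperSet K) (hYG : Y ⊆ G'')
    (hYK : μ⟦p, Y ∩ K⟧ = μ⟦p, Y⟧ * μ⟦p, K⟧) :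
    0 ≤ sahiE (bernoulliWeight p) 3 ![ind A, ind Y, ind (K ∩ G'')] := by
  refine le_trans (mul_nonneg ?_ ?_) (sahiE_three_ind_ge_of_indep_inter_absorb p hA hY hK hYG hYK)
  · exact sub_nonneg.2 (ex_ind_inter_le_left p K G'')
  · exact sub_nonneg.2 (harris_ex_ind p hA hY)

/-- The structural version: `Y` determined by a coordinate set `F`, `K` by its complement (so `Y ⟂ K` at every parameter). [this work] -/
theorem sahiE_three_ind_nonneg_of_indep_inter_absorb_of_determinedBy (p : ι → unitInterval) (F : Finset ι)
    {A Y K G'' : Set (Set ι)} (hA : IsUpperSet A) (hY : IsUpperSet Y) (hK : IsUpperSet K)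
    (hYG : Y ⊆ G'') (hYF : DeterminedBy Y (↑F : Set ι)) (hKF : DeterminedBy K (↑F : Set ι)ᶜ) :
    0 ≤ sahiE (bernoulliWeight p) 3 ![ind A, ind Y, ind (K ∩ G'')] :=
  sahiE_three_ind_nonneg_of_indep_inter_absorb p hA hY hK hYG (Pointwise.ex_ind_inter_of_separated p F hYF hKF)

end SahiE3FSplit

end Summit.CriticalPhenomena.PercolationContinuityZ3.Theorems
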